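import Summits.QuantumFields.YangMills.Theorems.SwapVirialDeficitZeroModeExactAxialLaw
import Summits.QuantumFields.YangMills.Theorems.SwapVirialDeficitZeroModeExactPairBall
import HarnessLib

/-!
# Zero-mode EXACT rung Z3-L: the nearly commuting PAIR in Laplace form — `β·∫∫ e^{−β‖[q₁,q₂]‖²} dHaar² → 1/2` EXACTLY
# (free-hands support of crux ⟨stmt-QuantumFields-24197⟩ `SwapVirialDeficit.SwapGluedStiffness`; zero-mode exact rung of fcl-p3 g43's plan, pair case,
# Laplace form — the two-letter twin of w2 g55's three-letter block `Λ₃` (✓`ZeroModeGroup.laplaceThree`))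

By the commutator-square law ✓`lintegral_haar_comp_commSq` (file Z1-c: `‖[q a, q u]‖² ∼ 4‖Im q a‖²·U[0,1]`) the one-letter Laplace transform is EXACT,
`∫ e^{−β‖[q a, q u]‖²} dHaar(u) = φ(4β‖Im q a‖²)`, `φ(κ) = ∫₀¹e^{−κs}ds = (1 − e^{−κ})/κ`, hence (Tonelli)
`Λ₂(β) := ∫∫ e^{−β‖q₁q₂ − q₂q₁‖²} dHaar² = ∫ φ(4β‖Im q a‖²) dHaar(a)` and `β·Λ₂(β) = ∫ ψ_β(‖Im q a‖²) dHaar(a)` with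
`ψ_β(σ) = (1 − e^{−4βσ})/(4σ) ↑ 1/(4σ)` MONOTONICALLY in `β`.  Monotone convergence and ✓`lintegral_haar_profile` (`E[‖Im q‖⁻²] = 2`, file Z3) give
★★ `pair_laplace_le`: `β·Λ₂(β) ≤ 1/2` (`β ≥ 0`) and ★★★ `tendsto_pair_laplace`: `β·Λ₂(β) → 1/2` — exponent `1`, EXACT constant `1/2`, no logarithm (the Laplace
image of the small-ball law `Haar²{‖[q₁,q₂]‖ ≤ t} = t²/2 + O(t³)` of ✓`abs_haar_pair_commBall_sub_le`).

HONEST LABEL: exact finite-dimensional Haar asymptotics (plan-level zero-mode rung of a DRAFT line); NOT the fixed-`L` sharp law, NOT ⟨24197⟩; no rung /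
summit statement is proved; the Yang–Mills mass gap is NOT proved; no summit is proved by a line.  Width seat ym-line-sfw-p2-w3 g62 (cell ym-idea-1,
free hands; own crux ⟨22884⟩ blocked-on ⟨19935⟩), `--supports stmt-QuantumFields-24197`.  THEOREMS ONLY, standard axioms, 0 `sorry`.
References: [cite: Chatterjee2026YMHiggs, Lemma 5.1 / Cor. 5.2]; [folklore].
-/

set_option autoImplicit false

noncomputable section

open MeasureTheory Quaternion Set Real Filter
open scoped Quaternion ENNReal BigOperators Topology
open Literature.MathematicalPhysics.QuantumLattice
open Literature.MathematicalPhysics.QuantumFieldTheory (haarProbability)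
open Literature.MathematicalPhysics.QuantumFieldTheory.Balaban1983to89.T4HaarSU2Translate (su2Quat_quatToSU2 measurable_su2Quat
  continuous_su2Quat)
open Summit.QuantumFields.YangMills.Theorems.SwapTwistDeficit.ToronLog
open Summit.QuantumFields.YangMills.Theorems.ToronValleyVolume.NearlyCommutingCeiling (sq_norm_im_eq)

attribute [local instance] Literature.Analysis.FluidPDE.Tao2016.quatMeasurableSpace
  Literature.Analysis.FluidPDE.Tao2016.quatBorelSpace
  Literature.MathematicalPhysics.QuantumLattice.secondCountableTopology_su2

namespace Summit.QuantumFields.YangMills.Theorems.SwapVirialDeficit.ZeroModeExact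

/-! ## §14 The one-letter Laplace transform is exact -/

/-- `∫₀¹ e^{−κs} ds = (1 − e^{−κ})/κ` for `κ ≠ 0`. [folklore] -/
theorem integral_exp_neg_mul_unit {κ : ℝ} (hκ : κ ≠ 0) : ∫ s in (0 : ℝ)..1, Real.exp (-(κ * s)) = (1 - Real.exp (-κ)) / κ := by
  have h := intervalIntegral.integral_comp_mul_left (a := 0) (b := 1) (fun x => Real.exp x) (neg_ne_zero.2 hκ)
  simp only [mul_zero, mul_one, integral_exp, Real.exp_zero, smul_eq_mul] at h
  rw [show (fun s : ℝ => Real.exp (-(κ * s))) = fun s => Real.exp (-κ * s) from funext fun s => by ring_nf, h]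
  field_simp
  ring

/-- As a lower integral over `[0,1]`: `∫_{[0,1]} e^{−κs} ds = (1 − e^{−κ})/κ` (`κ ≠ 0`). [folklore] -/
theorem lintegral_exp_neg_mul_unit {κ : ℝ} (hκ : κ ≠ 0) :
    ∫⁻ s in Icc (0 : ℝ) 1, ENNReal.ofReal (Real.exp (-(κ * s))) = ENNReal.ofReal ((1 - Real.exp (-κ)) / κ) := by
  rw [← ofReal_integral_eq_lintegral_ofReal ((by fun_prop : Continuous fun s : ℝ => Real.exp (-(κ * s))).integrableOn_Icc)
    (Filter.Eventually.of_forall fun s => (Real.exp_pos _).le), integral_Icc_eq_integral_Ioc,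
    ← intervalIntegral.integral_of_le zero_le_one, integral_exp_neg_mul_unit hκ]

/-- ★ **EXACT ONE-LETTER LAPLACE TRANSFORM**: for `a` with `Im q a ≠ 0` and `β > 0`,
`∫ e^{−β‖q a·q u − q u·q a‖²} dHaar(u) = (1 − e^{−4β‖Im q a‖²})/(4β‖Im q a‖²)`. [folklore] -/
theorem lintegral_haar_exp_commSq {a : Matrix.specialUnitaryGroup (Fin 2) ℂ} (ha : (su2Quat a).im ≠ 0) {β : ℝ} (hβ : 0 < β) :
    ∫⁻ u, ENNReal.ofReal (Real.exp (-(β * ‖su2Quat a * su2Quat u - su2Quat u * su2Quat a‖ ^ 2)))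
        ∂(haarProbability (Matrix.specialUnitaryGroup (Fin 2) ℂ)) =
      ENNReal.ofReal ((1 - Real.exp (-(4 * β * ‖(su2Quat a).im‖ ^ 2))) / (4 * β * ‖(su2Quat a).im‖ ^ 2)) := by
  have hs : 0 < ‖(su2Quat a).im‖ := norm_pos_iff.2 ha
  have hκ : 4 * β * ‖(su2Quat a).im‖ ^ 2 ≠ 0 := by positivity
  have hg : Measurable fun x : ℝ => ENNReal.ofReal (Real.exp (-(β * x))) := ENNReal.measurable_ofReal.comp (by fun_prop)
  rw [show (fun u : Matrix.specialUnitaryGroup (Fin 2) ℂ =>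
      ENNReal.ofReal (Real.exp (-(β * ‖su2Quat a * su2Quat u - su2Quat u * su2Quat a‖ ^ 2)))) =
      fun u => (fun x : ℝ => ENNReal.ofReal (Real.exp (-(β * x)))) (‖su2Quat a * su2Quat u - su2Quat u * su2Quat a‖ ^ 2) from rfl,
    lintegral_haar_comp_commSq a _ hg]
  rw [← lintegral_exp_neg_mul_unit hκ]
  refine lintegral_congr fun s => ?_
  congr 2; ring

/-! ## §15 The pair Laplace transform `Λ₂(β)`: Tonelli, the monotone profile `ψ_β`, and the ceiling `β·Λ₂(β) ≤ 1/2` -/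

/-- The monotone profile `ψ_β(σ) = (1 − e^{−4βσ})/(4σ)` (its value at `σ = 0` is immaterial: central letters are Haar-null). [folklore] -/
theorem psi_mono {σ : ℝ} (hσ : 0 < σ) {β β' : ℝ} (h : β ≤ β') :
    (1 - Real.exp (-(4 * β * σ))) / (4 * σ) ≤ (1 - Real.exp (-(4 * β' * σ))) / (4 * σ) := by
  refine div_le_div_of_nonneg_right ?_ (by positivity)
  have : Real.exp (-(4 * β' * σ)) ≤ Real.exp (-(4 * β * σ)) := Real.exp_le_exp.2 (by nlinarith)
  linarith

/-- `ψ_β(σ) ≤ 1/(4σ)`. [folklore] -/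
theorem psi_le {σ : ℝ} (hσ : 0 < σ) (β : ℝ) : (1 - Real.exp (-(4 * β * σ))) / (4 * σ) ≤ 1 / (4 * σ) :=
  div_le_div_of_nonneg_right (by linarith [Real.exp_pos (-(4 * β * σ))]) (by positivity)

/-- `ψ_β(σ) → 1/(4σ)` as `β → ∞` (`σ > 0`). [folklore] -/
theorem tendsto_psi {σ : ℝ} (hσ : 0 < σ) :
    Tendsto (fun β : ℝ => (1 - Real.exp (-(4 * β * σ))) / (4 * σ)) atTop (𝓝 (1 / (4 * σ))) := by
  have h1 : Tendsto (fun β : ℝ => Real.exp (-(4 * β * σ))) atTop (𝓝 0) := by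
    have h4 : Tendsto (fun β : ℝ => 4 * β * σ) atTop atTop :=
      (tendsto_id.const_mul_atTop (by norm_num : (0 : ℝ) < 4)).atTop_mul_const hσ
    have : Tendsto (fun β : ℝ => -(4 * β * σ)) atTop atBot := tendsto_neg_atTop_atBot.comp h4
    exact Real.tendsto_exp_atBot.comp this
  have := ((tendsto_const_nhds (x := (1 : ℝ))).sub h1).div_const (4 * σ)
  simpa using this

/-- The pair integrand is measurable on `SU(2) × SU(2)`. [folklore] -/
theorem measurable_pairExp (β : ℝ) :
    Measurable fun p : Matrix.specialUnitaryGroup (Fin 2) ℂ × Matrix.specialUnitaryGroup (Fin 2) ℂ =>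
      ENNReal.ofReal (Real.exp (-(β * ‖su2Quat p.1 * su2Quat p.2 - su2Quat p.2 * su2Quat p.1‖ ^ 2))) := by
  have h1 : Continuous fun p : Matrix.specialUnitaryGroup (Fin 2) ℂ × Matrix.specialUnitaryGroup (Fin 2) ℂ => su2Quat p.1 :=
    continuous_su2Quat.comp continuous_fst
  have h2 : Continuous fun p : Matrix.specialUnitaryGroup (Fin 2) ℂ × Matrix.specialUnitaryGroup (Fin 2) ℂ => su2Quat p.2 :=
    continuous_su2Quat.comp continuous_snd
  exact ENNReal.measurable_ofReal.comp ((Real.continuous_exp.comp ((((h1.mul h2).sub (h2.mul h1)).norm.pow 2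
    |>.const_smul β |>.neg))).measurable)

/-- ★★ **TONELLI + THE ONE-LETTER LAW**: `β·Λ₂(β) = ∫ ψ_β(‖Im q a‖²) dHaar(a)` for `β > 0`, as lower integrals
(`Λ₂(β) = ∫∫ e^{−β‖q₁q₂ − q₂q₁‖²} dHaar²`). [folklore] -/
theorem mul_pairLaplace_eq {β : ℝ} (hβ : 0 < β) :
    ENNReal.ofReal β * ∫⁻ p, ENNReal.ofReal (Real.exp (-(β * ‖su2Quat p.1 * su2Quat p.2 - su2Quat p.2 * su2Quat p.1‖ ^ 2)))
        ∂((haarProbability (Matrix.specialUnitaryGroup (Fin 2) ℂ)).prod (haarProbability (Matrix.specialUnitaryGroup (Fin 2) ℂ))) =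
      ∫⁻ a, ENNReal.ofReal ((1 - Real.exp (-(4 * β * ‖(su2Quat a).im‖ ^ 2))) / (4 * ‖(su2Quat a).im‖ ^ 2))
        ∂(haarProbability (Matrix.specialUnitaryGroup (Fin 2) ℂ)) := by
  rw [lintegral_prod _ (measurable_pairExp β).aemeasurable, ← lintegral_const_mul' _ _ ENNReal.ofReal_ne_top]
  refine lintegral_congr_ae ?_
  have hae : ∀ᵐ a ∂(haarProbability (Matrix.specialUnitaryGroup (Fin 2) ℂ)), (su2Quat a).im ≠ 0 :=
    ae_iff.2 (by simpa using haar_im_eq_zero_null)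
  filter_upwards [hae] with a ha
  have hs : 0 < ‖(su2Quat a).im‖ := norm_pos_iff.2 ha
  rw [lintegral_haar_exp_commSq ha hβ, ← ENNReal.ofReal_mul hβ.le]
  congr 1
  field_simp

/-- ★★ **CEILING**: `β·Λ₂(β) ≤ 1/2` for every `β > 0`. [folklore] -/
theorem mul_pairLaplace_le {β : ℝ} (hβ : 0 < β) :
    ENNReal.ofReal β * ∫⁻ p, ENNReal.ofReal (Real.exp (-(β * ‖su2Quat p.1 * su2Quat p.2 - su2Quat p.2 * su2Quat p.1‖ ^ 2)))
        ∂((haarProbability (Matrix.specialUnitaryGroup (Fin 2) ℂ)).prod (haarProbability (Matrix.specialUnitaryGroup (Fin 2) ℂ))) ≤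
      ENNReal.ofReal (1 / 2) := by
  rw [mul_pairLaplace_eq hβ, show (1 / 2 : ℝ) = 1 ^ 2 / 2 by norm_num, ← lintegral_haar_profile 1]
  have hae : ∀ᵐ a ∂(haarProbability (Matrix.specialUnitaryGroup (Fin 2) ℂ)), (su2Quat a).im ≠ 0 :=
    ae_iff.2 (by simpa using haar_im_eq_zero_null)
  refine lintegral_mono_ae (hae.mono fun a ha => ENNReal.ofReal_le_ofReal ?_)
  have hs : 0 < ‖(su2Quat a).im‖ ^ 2 := by have := norm_pos_iff.2 ha; positivity
  rw [one_pow]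
  exact psi_le hs β

/-! ## §16 ★★★ Monotone convergence: `β·Λ₂(β) → 1/2` -/

/-- MONOTONE CONVERGENCE along `β = n + 1`: `⨆ₙ (n+1)·Λ₂(n+1) = 1/2`. [folklore] -/
theorem iSup_mul_pairLaplace_nat :
    ⨆ n : ℕ, ENNReal.ofReal ((n : ℝ) + 1) * ∫⁻ p, ENNReal.ofReal (Real.exp (-(((n : ℝ) + 1) *
        ‖su2Quat p.1 * su2Quat p.2 - su2Quat p.2 * su2Quat p.1‖ ^ 2)))
        ∂((haarProbability (Matrix.specialUnitaryGroup (Fin 2) ℂ)).prod (haarProbability (Matrix.specialUnitaryGroup (Fin 2) ℂ))) =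
      ENNReal.ofReal (1 / 2) := by
  have heq : ∀ n : ℕ, ENNReal.ofReal ((n : ℝ) + 1) * ∫⁻ p, ENNReal.ofReal (Real.exp (-(((n : ℝ) + 1) *
        ‖su2Quat p.1 * su2Quat p.2 - su2Quat p.2 * su2Quat p.1‖ ^ 2)))
        ∂((haarProbability (Matrix.specialUnitaryGroup (Fin 2) ℂ)).prod (haarProbability (Matrix.specialUnitaryGroup (Fin 2) ℂ))) =
      ∫⁻ a, ENNReal.ofReal ((1 - Real.exp (-(4 * ((n : ℝ) + 1) * ‖(su2Quat a).im‖ ^ 2))) / (4 * ‖(su2Quat a).im‖ ^ 2))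
        ∂(haarProbability (Matrix.specialUnitaryGroup (Fin 2) ℂ)) := fun n => mul_pairLaplace_eq (by positivity)
  simp_rw [heq]
  have hmeas : ∀ n : ℕ, Measurable fun a : Matrix.specialUnitaryGroup (Fin 2) ℂ =>
      ENNReal.ofReal ((1 - Real.exp (-(4 * ((n : ℝ) + 1) * ‖(su2Quat a).im‖ ^ 2))) / (4 * ‖(su2Quat a).im‖ ^ 2)) := by
    intro n
    have hc : Continuous fun a : Matrix.specialUnitaryGroup (Fin 2) ℂ => ‖(su2Quat a).im‖ ^ 2 :=
      ((Quaternion.continuous_im.comp continuous_su2Quat).norm).pow 2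
    exact ENNReal.measurable_ofReal.comp ((measurable_const.sub (Real.measurable_exp.comp
      ((hc.measurable.const_mul (4 * ((n : ℝ) + 1))).neg))).div (hc.measurable.const_mul 4))
  -- pointwise monotone in `n` off the null set of central letters; we use the everywhere-monotone regularisation via `max`
  have hmono : Monotone fun (n : ℕ) (a : Matrix.specialUnitaryGroup (Fin 2) ℂ) =>
      ENNReal.ofReal ((1 - Real.exp (-(4 * ((n : ℝ) + 1) * ‖(su2Quat a).im‖ ^ 2))) / (4 * ‖(su2Quat a).im‖ ^ 2)) := by
    intro m n h a
    by_cases hs : ‖(su2Quat a).im‖ ^ 2 = 0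
    · simp [hs]
    · have hs' : 0 < ‖(su2Quat a).im‖ ^ 2 := lt_of_le_of_ne (sq_nonneg _) (Ne.symm hs)
      exact ENNReal.ofReal_le_ofReal (psi_mono hs' (by exact_mod_cast Nat.succ_le_succ h))
  rw [← lintegral_iSup hmeas hmono, show (1 / 2 : ℝ) = 1 ^ 2 / 2 by norm_num, ← lintegral_haar_profile 1]
  have hae : ∀ᵐ a ∂(haarProbability (Matrix.specialUnitaryGroup (Fin 2) ℂ)), (su2Quat a).im ≠ 0 :=
    ae_iff.2 (by simpa using haar_im_eq_zero_null)
  refine lintegral_congr_ae (hae.mono fun a ha => ?_)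
  have hs : 0 < ‖(su2Quat a).im‖ ^ 2 := by have := norm_pos_iff.2 ha; positivity
  have hmono' : Monotone fun n : ℕ =>
      ENNReal.ofReal ((1 - Real.exp (-(4 * ((n : ℝ) + 1) * ‖(su2Quat a).im‖ ^ 2))) / (4 * ‖(su2Quat a).im‖ ^ 2)) :=
    fun m n h => ENNReal.ofReal_le_ofReal (psi_mono hs (by exact_mod_cast Nat.succ_le_succ h))
  have ht : Tendsto (fun n : ℕ =>
      ENNReal.ofReal ((1 - Real.exp (-(4 * ((n : ℝ) + 1) * ‖(su2Quat a).im‖ ^ 2))) / (4 * ‖(su2Quat a).im‖ ^ 2))) atTop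
      (𝓝 (ENNReal.ofReal (1 ^ 2 / (4 * ‖(su2Quat a).im‖ ^ 2)))) := by
    rw [one_pow]
    exact (ENNReal.continuous_ofReal.tendsto _).comp
      ((tendsto_psi hs).comp (tendsto_atTop_add_const_right _ 1 tendsto_natCast_atTop_atTop))
  exact tendsto_nhds_unique (tendsto_atTop_iSup hmono') ht

/-- ★★★ **THE PAIR LAPLACE LAW**: `β·∫∫ e^{−β‖q₁q₂ − q₂q₁‖²} dHaar² → 1/2` as `β → ∞` — exponent `1`, EXACT constant `1/2`, no logarithm
(real form; the integral is the Bochner integral over `Haar × Haar`). [folklore] -/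
theorem tendsto_pair_laplace :
    Tendsto (fun β : ℝ => β * ∫ p, Real.exp (-(β * ‖su2Quat p.1 * su2Quat p.2 - su2Quat p.2 * su2Quat p.1‖ ^ 2))
      ∂((haarProbability (Matrix.specialUnitaryGroup (Fin 2) ℂ)).prod (haarProbability (Matrix.specialUnitaryGroup (Fin 2) ℂ))))
      atTop (𝓝 (1 / 2)) := by
  set μ2 := (haarProbability (Matrix.specialUnitaryGroup (Fin 2) ℂ)).prod (haarProbability (Matrix.specialUnitaryGroup (Fin 2) ℂ))
    with hμ2
  -- the real quantity as `toReal` of the lower integral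
  set f : ℝ → ℝ := fun β => β * ∫ p, Real.exp (-(β * ‖su2Quat p.1 * su2Quat p.2 - su2Quat p.2 * su2Quat p.1‖ ^ 2)) ∂μ2 with hf
  have hint : ∀ β : ℝ, 0 ≤ β → Integrable (fun p : Matrix.specialUnitaryGroup (Fin 2) ℂ × Matrix.specialUnitaryGroup (Fin 2) ℂ =>
      Real.exp (-(β * ‖su2Quat p.1 * su2Quat p.2 - su2Quat p.2 * su2Quat p.1‖ ^ 2))) μ2 := by
    intro β hβ
    refine Integrable.of_bound (C := 1) ?_ (Filter.Eventually.of_forall fun p => ?_)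
    · exact (ENNReal.measurable_toReal.comp (measurable_pairExp β)).aestronglyMeasurable.congr
        (Filter.Eventually.of_forall fun p => by simp [ENNReal.toReal_ofReal (Real.exp_pos _).le])
    · rw [Real.norm_eq_abs, abs_of_pos (Real.exp_pos _)]
      exact Real.exp_le_one_iff.2 (by nlinarith [sq_nonneg ‖su2Quat p.1 * su2Quat p.2 - su2Quat p.2 * su2Quat p.1‖])
  have hfM : ∀ β : ℝ, 0 < β → ENNReal.ofReal (f β) =
      ENNReal.ofReal β * ∫⁻ p, ENNReal.ofReal (Real.exp (-(β * ‖su2Quat p.1 * su2Quat p.2 - su2Quat p.2 * su2Quat p.1‖ ^ 2))) ∂μ2 := by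
    intro β hβ
    rw [hf]
    simp only []
    rw [ENNReal.ofReal_mul hβ.le, ofReal_integral_eq_lintegral_ofReal (hint β hβ.le)
      (Filter.Eventually.of_forall fun p => (Real.exp_pos _).le)]
  have hf0 : ∀ β : ℝ, 0 < β → 0 ≤ f β := fun β hβ => by
    rw [hf]; exact mul_nonneg hβ.le (integral_nonneg fun p => (Real.exp_pos _).le)
  -- ceiling and monotonicity of `f` on `(0, ∞)`
  have hle : ∀ β : ℝ, 0 < β → f β ≤ 1 / 2 := by
    intro β hβ
    have h := mul_pairLaplace_le hβ
    rw [← hfM β hβ] at h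
    exact (ENNReal.ofReal_le_ofReal_iff (by norm_num)).1 h
  have hmono : ∀ β β' : ℝ, 0 < β → β ≤ β' → f β ≤ f β' := by
    intro β β' hβ hββ'
    have hβ' : 0 < β' := lt_of_lt_of_le hβ hββ'
    have h : ENNReal.ofReal (f β) ≤ ENNReal.ofReal (f β') := by
      rw [hfM β hβ, hfM β' hβ', mul_pairLaplace_eq hβ, mul_pairLaplace_eq hβ']
      have hae : ∀ᵐ a ∂(haarProbability (Matrix.specialUnitaryGroup (Fin 2) ℂ)), (su2Quat a).im ≠ 0 :=
        ae_iff.2 (by simpa using haar_im_eq_zero_null)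
      refine lintegral_mono_ae (hae.mono fun a ha => ENNReal.ofReal_le_ofReal ?_)
      have hs : 0 < ‖(su2Quat a).im‖ ^ 2 := by have := norm_pos_iff.2 ha; positivity
      exact psi_mono hs hββ'
    exact (ENNReal.ofReal_le_ofReal_iff (hf0 β' hβ')).1 h
  -- the sequence `f(n+1) → 1/2`
  have hseq : Tendsto (fun n : ℕ => ENNReal.ofReal (f ((n : ℝ) + 1))) atTop (𝓝 (ENNReal.ofReal (1 / 2))) := by
    have hm : Monotone fun n : ℕ => ENNReal.ofReal (f ((n : ℝ) + 1)) := fun m n h =>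
      ENNReal.ofReal_le_ofReal (hmono ((m : ℝ) + 1) ((n : ℝ) + 1) (by positivity) (by exact_mod_cast Nat.succ_le_succ h))
    have h := tendsto_atTop_iSup hm
    rwa [show (⨆ n : ℕ, ENNReal.ofReal (f ((n : ℝ) + 1))) = ENNReal.ofReal (1 / 2) from by
      rw [← iSup_mul_pairLaplace_nat]
      exact iSup_congr fun n => hfM ((n : ℝ) + 1) (by positivity)] at h
  have hseq' : Tendsto (fun n : ℕ => f ((n : ℝ) + 1)) atTop (𝓝 (1 / 2)) := by
    have h := (ENNReal.tendsto_toReal (ENNReal.ofReal_ne_top (r := 1 / 2))).comp hseq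
    rw [ENNReal.toReal_ofReal (by norm_num)] at h
    refine h.congr fun n => ?_
    have hn : (0 : ℝ) < (n : ℝ) + 1 := by positivity
    simp [ENNReal.toReal_ofReal (hf0 _ hn)]
  -- squeeze: eventually `1/2 − ε < f(N+1) ≤ f β ≤ 1/2`
  rw [tendsto_order]
  constructor
  · intro b hb
    have hev : ∀ᶠ n : ℕ in atTop, b < f ((n : ℝ) + 1) := (tendsto_order.1 hseq').1 b hb
    obtain ⟨N, hN⟩ := hev.exists
    filter_upwards [eventually_ge_atTop ((N : ℝ) + 1)] with β hβ
    exact hN.trans_le (hmono ((N : ℝ) + 1) β (by positivity) hβ)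
  · intro b hb
    filter_upwards [eventually_gt_atTop (0 : ℝ)] with β hβ
    exact (hle β hβ).trans_lt hb

/-- ★★ **CEILING, real form**: `β·∫∫ e^{−β‖q₁q₂ − q₂q₁‖²} dHaar² ≤ 1/2` for `β ≥ 0`. [folklore] -/
theorem pair_laplace_le {β : ℝ} (hβ : 0 ≤ β) :
    β * ∫ p, Real.exp (-(β * ‖su2Quat p.1 * su2Quat p.2 - su2Quat p.2 * su2Quat p.1‖ ^ 2))
      ∂((haarProbability (Matrix.specialUnitaryGroup (Fin 2) ℂ)).prod (haarProbability (Matrix.specialUnitaryGroup (Fin 2) ℂ))) ≤ 1 / 2 := by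
  rcases hβ.eq_or_lt with h | hβ'
  · rw [← h, zero_mul]; norm_num
  have hint : Integrable (fun p : Matrix.specialUnitaryGroup (Fin 2) ℂ × Matrix.specialUnitaryGroup (Fin 2) ℂ =>
      Real.exp (-(β * ‖su2Quat p.1 * su2Quat p.2 - su2Quat p.2 * su2Quat p.1‖ ^ 2)))
      ((haarProbability (Matrix.specialUnitaryGroup (Fin 2) ℂ)).prod (haarProbability (Matrix.specialUnitaryGroup (Fin 2) ℂ))) := by
    refine Integrable.of_bound (C := 1) ?_ (Filter.Eventually.of_forall fun p => ?_)
    · exact (ENNReal.measurable_toReal.comp (measurable_pairExp β)).aestronglyMeasurable.congr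
        (Filter.Eventually.of_forall fun p => by simp [ENNReal.toReal_ofReal (Real.exp_pos _).le])
    · rw [Real.norm_eq_abs, abs_of_pos (Real.exp_pos _)]
      exact Real.exp_le_one_iff.2 (by nlinarith [sq_nonneg ‖su2Quat p.1 * su2Quat p.2 - su2Quat p.2 * su2Quat p.1‖])
  have h := mul_pairLaplace_le hβ'
  rw [← ofReal_integral_eq_lintegral_ofReal hint (Filter.Eventually.of_forall fun p => (Real.exp_pos _).le),
    ← ENNReal.ofReal_mul hβ'.le] at h
  exact (ENNReal.ofReal_le_ofReal_iff (by norm_num)).1 h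

end Summit.QuantumFields.YangMills.Theorems.SwapVirialDeficit.ZeroModeExact

end
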